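import Summits.NavierStokesRegularity.NavierStokesRegularity.Theses.WakeRatchet
import Summits.NavierStokesRegularity.NavierStokesRegularity.Theorems.TransitMassLedgerActionTransitExtractionSmallAmplitudeRung

/-!
# RUNG (PROVED): the dissipative regime of `WakeRatchet.EternalViscousRate` (stmt-NavierStokesRegularity-25647)

Ideator ns-idea-1 g9, LINE g9-2 «dissipation edge» — the standalone, sorry-free rung extracted from
`dissipation_edge_line.lean` (same declarations, minus the two stubs and the kernel), plus the packaged Prop
`DissipativeRegimeRung` with `dissipativeRegimeRung_holds`.  MODEL lattice only; nothing about NS; no summit or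
rung leaf is proved by this file — it proves an open REGIME (dissipation number 𝔇 = M/ν̂² ≤ 1/(128 (C_A+1)²),
every ε₀ ∈ (0,1], every cancelling table, rate a = 2) of the viscous child K1ᵛ of the route's deciding crux.
-/

noncomputable section

set_option linter.dupNamespace false

namespace Summit.NavierStokesRegularity.NavierStokesRegularity.Cruxes.EternalViscousRate.DissipationEdge

open Set Filter Topology
open Literature.Analysis.FluidPDE Literature.Analysis.FluidPDE.TaoCascade
open Summit.NavierStokesRegularity.NavierStokesRegularity.Cruxes.ActionTransitExtraction.SmallAmplitudeRung (bigLam_le_eight)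

/-! ## Objects -/

/-- The DISSIPATION-EDGE THRESHOLD for the tail energy at base shell 0: `ν̂² / (128 (C_A + 1)²)`.
Below it the tail sits inside its own dissipation range. -/
def edgeThreshold (α : Fin 4 → Fin 4 → Fin 4 → ℤ × ℤ × ℤ → ℝ) (νh : ℝ) : ℝ :=
  νh ^ 2 / (128 * (fluxConst α + 1) ^ 2)

/-! ## The proved rung: the dissipative regime -/

/-- `1 < bigLam ε₀` for `0 < ε₀`. -/
theorem one_lt_bigLam {ε₀ : ℝ} (hε : 0 < ε₀) : 1 < bigLam ε₀ :=
  Real.one_lt_rpow (by linarith) (by norm_num)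

/-- Physical energies of a uniformly bounded profile are summable along every tail (geometric domination,
ratio `Λ^{-2} < 1`), so the `∑'` in K1ᵛ are genuine sums (no junk value). -/
theorem summable_physEnergy_tail {ε₀ : ℝ} (hε : 0 < ε₀) {W : ℤ → ℝ → Em 4} {B : ℝ}
    (hB : ∀ (k : ℤ) (σ : ℝ), ‖W k σ‖ ≤ B) (n : ℤ) (σ : ℝ) :
    Summable (fun k : ℕ => physEnergy ε₀ W (n + k) σ) := by
  have hΛ : 0 < bigLam ε₀ := bigLam_pos (by linarith)
  have hΛ1 : 1 < bigLam ε₀ := one_lt_bigLam hε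
  set r : ℝ := ((bigLam ε₀)⁻¹) ^ 2 with hr
  have hr0 : 0 ≤ r := by positivity
  have hr1 : r < 1 := by
    have : (bigLam ε₀)⁻¹ < 1 := inv_lt_one_of_one_lt₀ hΛ1
    have h0 : 0 ≤ (bigLam ε₀)⁻¹ := by positivity
    rw [hr]; nlinarith
  have hgeo : Summable (fun k : ℕ => ((bigLam ε₀ ^ n)⁻¹ ^ 2 * (Real.exp (2 * σ) * B ^ 2)) * r ^ k) :=
    (summable_geometric_of_lt_one hr0 hr1).mul_left _
  refine Summable.of_nonneg_of_le (fun k => physEnergy_nonneg _ _ _ _) (fun k => ?_) hgeo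
  unfold physEnergy
  have hzpow : (bigLam ε₀ ^ (n + (k : ℤ)))⁻¹ ^ 2 = (bigLam ε₀ ^ n)⁻¹ ^ 2 * r ^ k := by
    rw [zpow_add₀ hΛ.ne', zpow_natCast, hr, mul_inv, mul_pow, ← inv_pow, ← pow_mul, ← pow_mul,
      mul_comm k 2]
  rw [hzpow]
  have hW2 : ‖W (n + k) σ‖ ^ 2 ≤ B ^ 2 := pow_le_pow_left₀ (norm_nonneg _) (hB _ _) 2
  have h1 : Real.exp (2 * σ) * ‖W (n + k) σ‖ ^ 2 ≤ Real.exp (2 * σ) * B ^ 2 :=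
    mul_le_mul_of_nonneg_left hW2 (Real.exp_pos _).le
  calc (bigLam ε₀ ^ n)⁻¹ ^ 2 * r ^ k * (Real.exp (2 * σ) * ‖W (n + ↑k) σ‖ ^ 2)
      ≤ (bigLam ε₀ ^ n)⁻¹ ^ 2 * r ^ k * (Real.exp (2 * σ) * B ^ 2) := by
        apply mul_le_mul_of_nonneg_left h1; positivity
    _ = (bigLam ε₀ ^ n)⁻¹ ^ 2 * (Real.exp (2 * σ) * B ^ 2) * r ^ k := by ring

/-- **RUNG (dissipative regime of K1ᵛ), PROVED.**  For `ε₀ ∈ (0,1]`, a cancelling table, `ν̂ > 0`, a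
uniformly bounded admissible viscous eternal solution and a tail bound `M` at base shell `0` below the
dissipation-edge threshold `ν̂²/(128 (C_A+1)²)`, the next tail is bounded by `(1+ε₀)^{-2} M` at all
log-times.  Mechanism: `physEnergy_succ_le` iterated — `E_k ≤ M·128^{-k}`. -/
theorem dissipativeRegime (ε₀ : ℝ) (hε : 0 < ε₀) (hε1 : ε₀ ≤ 1)
    (α : Fin 4 → Fin 4 → Fin 4 → ℤ × ℤ × ℤ → ℝ) (hc : IsCancellingCoeff α)
    (νh : ℝ) (W : ℤ → ℝ → Em 4) (hν : 0 < νh) (hW : IsEternalVisc ε₀ νh α W) (hUB : UniformBound W)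
    (M : ℝ) (hM : M ≤ edgeThreshold α νh)
    (hT : ∀ σ : ℝ, ∑' k : ℕ, physEnergy ε₀ W (0 + k) σ ≤ M) :
    ∀ σ : ℝ, ∑' k : ℕ, physEnergy ε₀ W (0 + 1 + k) σ ≤ (1 + ε₀) ^ (-(2 : ℝ)) * M := by
  obtain ⟨B, hB⟩ := hUB
  have hΛ : 0 < bigLam ε₀ := bigLam_pos (by linarith)
  have hΛ0 : 0 ≤ bigLam ε₀ := hΛ.le
  have hΛ8 : bigLam ε₀ ≤ 8 := bigLam_le_eight hε hε1
  have hCA : 0 ≤ fluxConst α := fluxConst_nonneg α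
  have hsum0 : ∀ σ, Summable (fun k : ℕ => physEnergy ε₀ W (0 + k) σ) :=
    fun σ => summable_physEnergy_tail hε hB 0 σ
  have hM0 : 0 ≤ M :=
    (tsum_nonneg fun k : ℕ => physEnergy_nonneg ε₀ W (0 + (k : ℤ)) 0).trans (hT 0)
  -- the threshold in the form used below: `C_A² M ≤ ν̂² / 128`
  have hkey : fluxConst α ^ 2 * M ≤ νh ^ 2 / 128 := by
    have hpos : (0 : ℝ) < 128 * (fluxConst α + 1) ^ 2 := by positivity
    have h2 : M * (128 * (fluxConst α + 1) ^ 2) ≤ νh ^ 2 := by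
      have h := hM
      unfold edgeThreshold at h
      exact (le_div_iff₀ hpos).1 h
    have h1 : fluxConst α ^ 2 * M ≤ (fluxConst α + 1) ^ 2 * M :=
      mul_le_mul_of_nonneg_right (by nlinarith) hM0
    rw [le_div_iff₀ (by norm_num : (0 : ℝ) < 128)]
    nlinarith
  -- geometric envelope `E_{0+k} ≤ M · 128^{-k}` by the shell step
  have henv : ∀ k : ℕ, ∀ σ, physEnergy ε₀ W (0 + (k : ℤ)) σ ≤ M * (1 / 128 : ℝ) ^ k := by
    intro k
    induction k with
    | zero =>
      intro σ
      have h := (hsum0 σ).le_tsum 0 (fun j _ => physEnergy_nonneg _ _ _ _)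
      have h' := h.trans (hT σ)
      simpa using h'
    | succ k ih =>
      intro σ
      have hSE0 : 0 ≤ M * (1 / 128 : ℝ) ^ k := by positivity
      have hstep := physEnergy_succ_le (m := 4) hε hν hW hc (n₀ := 0) (C := B)
        (fun j _ τ => hB j τ) (N := (0 : ℤ) + (k : ℕ)) (by push_cast; positivity) hSE0 ih σ
      have hidx : (0 : ℤ) + ((k + 1 : ℕ) : ℤ) = 0 + (k : ℤ) + 1 := by push_cast; ring
      rw [hidx]
      simp only [zero_add, zpow_natCast] at hstep ⊢
      obtain ⟨D, hD1, hstep'⟩ : ∃ D : ℝ, 1 ≤ D ∧ physEnergy ε₀ W ((k : ℤ) + 1) σ ≤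
          (fluxConst α * bigLam ε₀ ^ k * (M * (1 / 128 : ℝ) ^ k) / (νh * D)) ^ 2 :=
        ⟨_, Real.one_le_rpow (by linarith) (by push_cast; positivity), hstep⟩
      have hA0 : 0 ≤ fluxConst α * bigLam ε₀ ^ k * (M * (1 / 128 : ℝ) ^ k) := by positivity
      have hq0 : 0 ≤ fluxConst α * bigLam ε₀ ^ k * (M * (1 / 128 : ℝ) ^ k) / (νh * D) := by
        have : 0 < νh * D := mul_pos hν (by linarith)
        positivity
      have h1 : fluxConst α * bigLam ε₀ ^ k * (M * (1 / 128 : ℝ) ^ k) / (νh * D)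
          ≤ fluxConst α * bigLam ε₀ ^ k * (M * (1 / 128 : ℝ) ^ k) / νh :=
        div_le_div_of_nonneg_left hA0 hν (le_mul_of_one_le_right hν.le hD1)
      have h2 : fluxConst α * bigLam ε₀ ^ k * (M * (1 / 128 : ℝ) ^ k) / νh
          ≤ fluxConst α * 8 ^ k * (M * (1 / 128 : ℝ) ^ k) / νh := by
        apply div_le_div_of_nonneg_right _ hν.le
        apply mul_le_mul_of_nonneg_right _ hSE0
        exact mul_le_mul_of_nonneg_left (pow_le_pow_left₀ hΛ0 hΛ8 k) hCA
      have hu2 : ((8 : ℝ) ^ k * (1 / 128 : ℝ) ^ k) ^ 2 ≤ (1 / 128 : ℝ) ^ k := by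
        rw [← mul_pow, ← pow_mul, mul_comm k 2, pow_mul]
        exact pow_le_pow_left₀ (by norm_num) (by norm_num) k
      have hfin : (fluxConst α * 8 ^ k * (M * (1 / 128 : ℝ) ^ k) / νh) ^ 2
          ≤ M * (1 / 128 : ℝ) ^ (k + 1) := by
        rw [div_pow, div_le_iff₀ (by positivity : (0 : ℝ) < νh ^ 2)]
        calc (fluxConst α * 8 ^ k * (M * (1 / 128 : ℝ) ^ k)) ^ 2
            = (fluxConst α ^ 2 * M) * (M * (((8 : ℝ) ^ k * (1 / 128 : ℝ) ^ k) ^ 2)) := by ring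
          _ ≤ (νh ^ 2 / 128) * (M * (1 / 128 : ℝ) ^ k) :=
              mul_le_mul hkey (mul_le_mul_of_nonneg_left hu2 hM0) (by positivity) (by positivity)
          _ = M * (1 / 128 : ℝ) ^ (k + 1) * νh ^ 2 := by ring
      exact hstep'.trans ((pow_le_pow_left₀ hq0 (h1.trans h2) 2).trans hfin)
  -- sum the envelope over the next tail
  intro σ
  have hterm : ∀ k : ℕ, physEnergy ε₀ W (0 + 1 + (k : ℤ)) σ ≤ M * (1 / 128 : ℝ) * (1 / 128 : ℝ) ^ k := by
    intro k
    have h := henv (k + 1) σ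
    have hidx : (0 : ℤ) + 1 + (k : ℤ) = 0 + ((k + 1 : ℕ) : ℤ) := by push_cast; ring
    rw [hidx]
    calc _ ≤ M * (1 / 128 : ℝ) ^ (k + 1) := h
      _ = M * (1 / 128 : ℝ) * (1 / 128 : ℝ) ^ k := by ring
  have hg : Summable (fun k : ℕ => M * (1 / 128 : ℝ) * (1 / 128 : ℝ) ^ k) :=
    (summable_geometric_of_lt_one (by norm_num) (by norm_num)).mul_left _
  have hf : Summable (fun k : ℕ => physEnergy ε₀ W (0 + 1 + (k : ℤ)) σ) :=
    Summable.of_nonneg_of_le (fun k => physEnergy_nonneg _ _ _ _) hterm hg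
  have hsq : (1 + ε₀) ^ 2 ≤ 4 := by nlinarith
  have hpos2 : (0 : ℝ) < (1 + ε₀) ^ 2 := by positivity
  have h4 : (1 : ℝ) / 4 ≤ ((1 + ε₀) ^ 2)⁻¹ := by
    rw [← one_div]; exact one_div_le_one_div_of_le hpos2 hsq
  calc ∑' k : ℕ, physEnergy ε₀ W (0 + 1 + (k : ℤ)) σ
      ≤ ∑' k : ℕ, M * (1 / 128 : ℝ) * (1 / 128 : ℝ) ^ k := hf.tsum_le_tsum hterm hg
    _ = M * (1 / 128 : ℝ) * (1 - 1 / 128 : ℝ)⁻¹ := by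
        rw [tsum_mul_left, tsum_geometric_of_lt_one (by norm_num) (by norm_num)]
    _ ≤ (1 / 4 : ℝ) * M := by norm_num; nlinarith
    _ ≤ ((1 + ε₀) ^ 2)⁻¹ * M := mul_le_mul_of_nonneg_right h4 hM0
    _ = (1 + ε₀) ^ (-(2 : ℝ)) * M := by
        rw [Real.rpow_neg (by linarith), Real.rpow_two]

/-! ## Packaged rung -/

/-- The dissipative regime of K1ᵛ as a closed Prop (shape of `EternalViscousRate` with `a = 2`, `εs = 1`,
base shell `0`, the class guard `IsCancellingCoeff` (weaker than `InTableClass R`) and the regime hypothesis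
`M ≤ ν̂²/(128 (C_A+1)²)`). -/
def DissipativeRegimeRung : Prop :=
  ∀ ε₀ : ℝ, 0 < ε₀ → ε₀ ≤ 1 → ∀ α : Fin 4 → Fin 4 → Fin 4 → ℤ × ℤ × ℤ → ℝ, IsCancellingCoeff α →
    ∀ (νh : ℝ) (W : ℤ → ℝ → Em 4), 0 < νh → IsEternalVisc ε₀ νh α W → UniformBound W →
    ∀ M : ℝ, M ≤ edgeThreshold α νh → (∀ σ : ℝ, ∑' k : ℕ, physEnergy ε₀ W (0 + k) σ ≤ M) →
    ∀ σ : ℝ, ∑' k : ℕ, physEnergy ε₀ W (0 + 1 + k) σ ≤ (1 + ε₀) ^ (-(2 : ℝ)) * M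

/-- The dissipative-regime rung holds (by `dissipativeRegime`). -/
theorem dissipativeRegimeRung_holds : DissipativeRegimeRung :=
  fun ε₀ hε hε1 α hc νh W hν hW hUB M hM hT => dissipativeRegime ε₀ hε hε1 α hc νh W hν hW hUB M hM hT

/-- The same on the route's class `InTableClass R` (any `R`). -/
theorem dissipativeRegime_of_inTableClass {R ε₀ : ℝ} (hε : 0 < ε₀) (hε1 : ε₀ ≤ 1)
    {α : Fin 4 → Fin 4 → Fin 4 → ℤ × ℤ × ℤ → ℝ} (hα : InTableClass R α)
    {νh : ℝ} {W : ℤ → ℝ → Em 4} (hν : 0 < νh) (hW : IsEternalVisc ε₀ νh α W) (hUB : UniformBound W)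
    {M : ℝ} (hM : M ≤ edgeThreshold α νh) (hT : ∀ σ : ℝ, ∑' k : ℕ, physEnergy ε₀ W (0 + k) σ ≤ M) :
    ∀ σ : ℝ, ∑' k : ℕ, physEnergy ε₀ W (0 + 1 + k) σ ≤ (1 + ε₀) ^ (-(2 : ℝ)) * M :=
  dissipativeRegime ε₀ hε hε1 α hα.2.1 νh W hν hW hUB M hM hT

end Summit.NavierStokesRegularity.NavierStokesRegularity.Cruxes.EternalViscousRate.DissipationEdge

end
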